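import Summits.CriticalPhenomena.PercolationContinuityZ3.Theorems.PercAnnulusCrossingIICInsideFarQuasiIndependence
import Summits.CriticalPhenomena.PercolationContinuityZ3.Theorems.PercAnnulusCrossingIICTwoPointSandwich
import HarnessLib

/-!
# A near site joins Kesten's IIC at the one-arm price, whatever far sites it contains (lane RSW3, p1 gen 21)

builds on p205010 (kernel theorem, internal audit signed; external expert review pending) — NOT used in this file
(only `p_c(ℤ^d) > 0`).

RSW3 lane (LANE 3 `prim-rsw3`), seat `prim-rsw3-p1` (gen 21).  Helper file (`--supports stmt-CriticalPhenomena-4575`);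
no definitions, no sorries.  Memo `run/shared/lean/prim/rsw3/P1-QM.md` §34 (§34.5, lemma (L)).

`…IICInsideFarQuasiIndependence` (`c·ν(D)·ν(S ⊆ C(0)) ≤ ν(D ∩ {S ⊆ C(0)})` for `D` read off `Λ(a−1)`, `S` off `Λ(la−1)`) with the inside
event `D = {0 ↔ v in Λ(2l‖v‖)}` and the localised two-point lower bound `ν(0 ↔ v in Λ(2l‖v‖)) ≥ c·π(2‖v‖)` (gen 18):

* **`exists_iicMeasure_real_openConn_inter_biInter_ge_criticalProbI`** — at `p_c(ℤ^d)`, `d ≥ 2`, under (A2)□(s,L) + `CU⁺_l` + UAD: there are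
  `n₀ ≥ 1` and `c > 0` such that for every finite measure `ν` with Kesten's IIC limit property, every site `v` with `‖v‖_∞ ≥ n₀` and every
  finite set of sites `S` with `S ∩ Λ((2l² + l)‖v‖_∞) = ∅`:
  **`c·π_{p_c}(‖v‖)·ν(S ⊆ C(0)) ≤ ν({0 ↔ v} ∩ {S ⊆ C(0)})`** — conditionally on containing any far configuration `S`, the IIC contains
  the near site `v` with probability `≥ c·π(‖v‖)` (`≍ ν(0 ↔ v)`): the lower-bound step (L) of the spanning-tree formula for the
  `k`-point function (P1-QM §34.5), uniformly in `S`.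
References: H. Kesten, Probab. Theory Relat. Fields 73 (1986) §2, Thm. (8); D. Basu, A. Sapozhnikov, ECP 22 (2017) Thm. 1.1.
-/

noncomputable section

namespace Summit.CriticalPhenomena.PercolationContinuityZ3.Theorems.Crossing

open MeasureTheory Filter Topology Literature.Probability.Percolation Literature.Probability.LatticeModels
open Literature.Probability.Percolation.DCT16
open Summit.CriticalPhenomena.PercolationContinuityZ3.Theorems.SurfaceTension

variable {d : ℕ}

open Classical in
/-- **A NEAR SITE JOINS KESTEN'S IIC AT THE ONE-ARM PRICE, WHATEVER FAR SITES IT CONTAINS** (`p_c(ℤ^d)`, `d ≥ 2`; (A2)□ at aspect `(s,L)`,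
`2 ≤ s ≤ L`, `ϰ > 0`; `CU⁺_l(c_U)`, `l ≥ 2`, `c_U > 0`; UAD): there are `n₀ ≥ 1` and `c > 0` such that for every finite measure `ν` with Kesten's
IIC limit property, every `v` with `‖v‖_∞ ≥ n₀` and every finite `S` with `z ∉ Λ((2l² + l)‖v‖_∞)` for all `z ∈ S`:
**`c·π_{p_c}(‖v‖)·ν(⋂_{z∈S}{0 ↔ z}) ≤ ν({0 ↔ v} ∩ ⋂_{z∈S}{0 ↔ z})`**. [cite: Kesten1986, §2, Thm. (8)] [cite: BasuSapozhnikov2017ECP, Thm. 1.1] -/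
theorem exists_iicMeasure_real_openConn_inter_biInter_ge_criticalProbI (hd : 2 ≤ d) {s L : ℕ} (hs : 2 ≤ s) (hsL : s ≤ L)
    {ϰ : ℝ} (hϰ : 0 < ϰ) (hA2 : SetToSetQuasiMultAspectAt d (criticalProbI d) s L ϰ) {l : ℕ} (hl : 2 ≤ l) {cU : ℝ} (hcU : 0 < cU)
    (hCU : ∀ a : ℕ, 1 ≤ a → ∀ E : Set (BondConfig (Site d)), IsUpperSet E → MeasurableSet E →
      cU * (bondPercolation (zdGraph d) (criticalProbI d)).real E ≤ (bondPercolation (zdGraph d) (criticalProbI d)).real (E ∩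
        {ω : BondConfig (Site d) | ∀ t ∈ innerBoundary (zdGraph d) (box d a), ∀ s ∈ innerBoundary (zdGraph d) (box d (l * a)),
          ∀ t' ∈ innerBoundary (zdGraph d) (box d a), ∀ s' ∈ innerBoundary (zdGraph d) (box d (l * a)),
          ω ∈ openConnIn (↑((box d (l * a) \ box d a) ∪ innerBoundary (zdGraph d) (box d a)) : Set (Site d)) t s →
          ω ∈ openConnIn (↑((box d (l * a) \ box d a) ∪ innerBoundary (zdGraph d) (box d a)) : Set (Site d)) t' s' →
          ω ∈ openConnIn (↑((box d (l * a) \ box d a) ∪ innerBoundary (zdGraph d) (box d a)) : Set (Site d)) s s'}))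
    (hUAD : ∀ ε : ℝ, 0 < ε → ∃ K₀ : ℕ, ∀ m : ℕ, 1 ≤ m → ∀ N : ℕ, K₀ * m ≤ N →
      (bondPercolation (zdGraph d) (criticalProbI d)).real (boxCrossing d m N) ≤ ε) :
    ∃ (n₀ : ℕ) (c : ℝ), 1 ≤ n₀ ∧ 0 < c ∧ ∀ (ν : Measure (BondConfig (Site d))) [IsFiniteMeasure ν],
      (∀ (F : Finset (Sym2 (Site d))) (E : Set (BondConfig (Site d))), MeasurableSet E → DeterminedBy E ↑F →
        Tendsto (fun n : ℕ => (bondPercolation (zdGraph d) (criticalProbI d)).real (E ∩ siteToBoundary d n) /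
          oneArmProb d (criticalProbI d) n) atTop (𝓝 (ν.real E))) →
      ∀ (v : Site d) (S : Finset (Site d)), n₀ ≤ Site.supNorm v → (∀ z ∈ S, z ∉ box d ((2 * l ^ 2 + l) * Site.supNorm v)) →
        c * oneArmProb d (criticalProbI d) (Site.supNorm v) * ν.real (⋂ z ∈ S, (openConn (0 : Site d) z : Set (BondConfig (Site d)))) ≤
          ν.real ((openConn (0 : Site d) v : Set (BondConfig (Site d))) ∩ ⋂ z ∈ S, (openConn (0 : Site d) z : Set (BondConfig (Site d)))) := by
  have hd1 : 1 ≤ d := le_trans (by norm_num) hd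
  have hp : 0 < ((criticalProbI d : unitInterval) : ℝ) := by
    rw [coe_criticalProbI]; exact criticalProb_zd_pos d hd1
  have hπ : ∀ m : ℕ, 0 < oneArmProb d (criticalProbI d) m := fun m => oneArmProb_pos hd1 _ hp m
  obtain ⟨cH, hcH, hH⟩ := exists_iicMeasure_real_inter_biInter_openConn_ge_mul_criticalProbI hd hs hsL hϰ hA2 hl hcU hCU
  obtain ⟨n₂, c₂, hn₂, hc₂, h2⟩ := exists_le_iicMeasure_real_openConnIn_criticalProbI hd hs hsL hϰ hA2 hl hcU hCU hUAD
  obtain ⟨B, hB, hR⟩ := Rsw3.exists_oneArmProb_ratio_of_setToSetQuasiMultAspectAt hd hs hsL hϰ hA2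
  refine ⟨n₂, cH * c₂ / B, hn₂, by positivity, fun ν _ hν v S hv hS => ?_⟩
  have hn1 : 1 ≤ Site.supNorm v := le_trans hn₂ hv
  -- the inside event `D = {0 ↔ v in Λ(2l‖v‖)}`, read off `Λ(a−1)` with `a = 2l‖v‖ + 1`
  have hDdet : DeterminedBy (openConnIn (↑(box d (2 * l * Site.supNorm v)) : Set (Site d)) (0 : Site d) v : Set (BondConfig (Site d)))
      (↑((box d (2 * l * Site.supNorm v + 1 - 1)).sym2) : Set (Sym2 (Site d))) := by
    rw [Nat.add_sub_cancel]
    exact determinedBy_openConnIn (↑(box d (2 * l * Site.supNorm v))) 0 v (K := ↑(box d (2 * l * Site.supNorm v)).sym2)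
      (by rw [Finset.coe_sym2])
  have hSfar : ∀ z ∈ S, z ∉ box d (l * (2 * l * Site.supNorm v + 1) - 1) := by
    intro z hz h
    refine hS z hz (box_mono d ?_ h)
    calc l * (2 * l * Site.supNorm v + 1) - 1 ≤ l * (2 * l * Site.supNorm v + 1) := Nat.sub_le _ _
      _ = 2 * l ^ 2 * Site.supNorm v + l := by ring
      _ ≤ 2 * l ^ 2 * Site.supNorm v + l * Site.supNorm v := Nat.add_le_add_left (Nat.le_mul_of_pos_right l hn1) _
      _ = (2 * l ^ 2 + l) * Site.supNorm v := by ring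
  have hmain := hH ν hν (2 * l * Site.supNorm v + 1) (by nlinarith) _ hDdet (measurableSet_openConnIn _ 0 v) S hSfar
  have hlow := h2 ν hν (Site.supNorm v) v hv (self_mem_sphere v)
  have hratio : oneArmProb d (criticalProbI d) (Site.supNorm v) ≤ B * oneArmProb d (criticalProbI d) (2 * Site.supNorm v) :=
    hR _ _ hn1 (by omega) (by omega)
  have hνS : 0 ≤ ν.real (⋂ z ∈ S, (openConn (0 : Site d) z : Set (BondConfig (Site d)))) := measureReal_nonneg
  have hsub : (openConnIn (↑(box d (2 * l * Site.supNorm v)) : Set (Site d)) (0 : Site d) v : Set (BondConfig (Site d))) ∩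
      (⋂ z ∈ S, (openConn (0 : Site d) z : Set (BondConfig (Site d)))) ⊆
      (openConn (0 : Site d) v : Set (BondConfig (Site d))) ∩ ⋂ z ∈ S, (openConn (0 : Site d) z : Set (BondConfig (Site d))) := by
    refine Set.inter_subset_inter_left _ ?_
    rw [Literature.Barriers.CriticalPhenomena.openConn_zero_eq_iUnion_openConnIn v]
    exact Set.subset_iUnion (fun m : ℕ => (openConnIn (↑(box d m) : Set (Site d)) (0 : Site d) v : Set (BondConfig (Site d)))) _
  calc cH * c₂ / B * oneArmProb d (criticalProbI d) (Site.supNorm v) * ν.real (⋂ z ∈ S, (openConn (0 : Site d) z : Set (BondConfig (Site d))))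
      ≤ cH * c₂ / B * (B * oneArmProb d (criticalProbI d) (2 * Site.supNorm v)) *
          ν.real (⋂ z ∈ S, (openConn (0 : Site d) z : Set (BondConfig (Site d)))) :=
        mul_le_mul_of_nonneg_right (mul_le_mul_of_nonneg_left hratio (by positivity)) hνS
    _ = cH * (c₂ * oneArmProb d (criticalProbI d) (2 * Site.supNorm v)) * ν.real (⋂ z ∈ S, (openConn (0 : Site d) z : Set (BondConfig (Site d)))) := by
        field_simp
    _ ≤ cH * ν.real (openConnIn (↑(box d (2 * l * Site.supNorm v)) : Set (Site d)) (0 : Site d) v) *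
          ν.real (⋂ z ∈ S, (openConn (0 : Site d) z : Set (BondConfig (Site d)))) :=
        mul_le_mul_of_nonneg_right (mul_le_mul_of_nonneg_left hlow hcH.le) hνS
    _ ≤ ν.real ((openConnIn (↑(box d (2 * l * Site.supNorm v)) : Set (Site d)) (0 : Site d) v : Set (BondConfig (Site d))) ∩
          ⋂ z ∈ S, (openConn (0 : Site d) z : Set (BondConfig (Site d)))) := hmain
    _ ≤ _ := measureReal_mono hsub (measure_ne_top _ _)

end Summit.CriticalPhenomena.PercolationContinuityZ3.Theorems.Crossing

end
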